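import Summits.BirchSwinnertonDyer.BirchSwinnertonDyer.Theorems.LeadingTermConsistencyOfItems
import Summits.BirchSwinnertonDyer.BirchSwinnertonDyer.Theorems.LeadingTermConsistencyBypass
import HarnessLib

/-!
# BirchSwinnertonDyer / LeadingTerm — crux `Consistency` (stmt-BirchSwinnertonDyer-16217):
# the EXACT two-child split `Consistency ↔ ConsistencyNonDeficient ∧ DeficientVanishing`

Strategist decomposition (unit `cstrat-stmt-BirchSwinnertonDyer-16217-s1`, 2026-08-17) of crux #2
`Consistency` of route `LeadingTerm` along the ONE fault line that matters for the route's deciding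
theorem: the sign of `r_an − r_MW`.

* Child **A = `ConsistencyNonDeficient`** — the crux restricted to the cells `r_an ≤ r_MW` (diagonal and
  excess): the leading-term consistency proper. On the diagonal `r_an = r_MW` it is the `p`-adic Beilinson
  identity WITH ITS RATIONAL CONSTANT (`r = 0`: Mazur–Swinnerton-Dyer interpolation, tree theorem
  `leadingTerm_consistency_of_rank_zero`; `r = 1`: Perrin-Riou 1987, the support item `RankLeOne`;
  `r ≥ 2`: the registered stub S2 of lines `Sketch`/`birth`, i.e. (R) BSD-rationality at the rank ∧ (T) the
  `p`-adic transfer given the constant — Burns–Kurihara–Sano arXiv:1910.07404 Conj. 1.1 / Cor. 1.10, OPEN);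
  the excess cells `r_an < r_MW` are emptied by crux #4 `SqueezeUBR2`. Modulo `SqueezeUBR2` and `RankLeOne`,
  child A is EQUIVALENT to S2 (`nonDeficient_iff_diagonalTwoLe_of_items`), hence to (R) ∧ (T)
  (`nonDeficient_iff_rationality_and_transfer_of_items`). Child A contains BSD-RATIONALITY in rank `≥ 2`
  (`rationality_of_nonDeficient`), which is NOT a consequence of the summit statement (BSD-rank): it is
  refined-BSD content (Tate 1974 Conj. 4(b) read modulo `ℚ^×`).
* Child **B = `DeficientVanishing`** — in every deficient cell `r_MW < r_an`, at every good ordinary `p ≥ 5`,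
  the `r_MW`-th Taylor coefficient of `L_p(f, α_p, T)` vanishes (`D`-free; the archimedean identity forces
  `q = 0` there). This is the ONLY part of the crux the deciding theorem `closes` consumes:
  `bsd_of_deficientVanishing_of_pinchPrime_of_squeezeUB : B → PinchPrime → SqueezeUBR2 → BirchSwinnertonDyer`
  (= the landed `bsd_of_pinchPrime_of_deficientVanishing`, p135377). Child B is WITHIN the summit
  (`deficientVanishing_of_bsd`: BSD-rank makes it vacuous) and is closed MODULO ITEMS
  (`deficientVanishing_of_katoCorankBound_of_selmerRankItems`: `KatoCorankBound` + route SelmerRank's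
  `SelmerRankLB` + `SelmerRankSmallImage`, = the landed `deficientVanishing_of_items`); unconditionally it is
  known in every cell except the matched-parity cells `(r_MW, r_an) = (r, r + 2k)`, `r ≥ 2`, `k ≥ 1`, where it
  is the rank-`r` `p`-converse (first open cell `(2,4)`).

The split is EXACT and item-free: `consistency_of_nonDeficient_of_deficientVanishing : A → B → Consistency`
(the `--glue-by` theorem; case split on `r_an ≤ r_MW`, deficient cells by `consistencyAt_of_coeff_eq_zero`),
`nonDeficient_of_consistency`, `deficientVanishing_of_consistency` (restriction; a canonical datum exists by
`exists_isCanonical_holds`, `log_p γ ≠ 0` by `leadingTerm_padicLog_cyclotomicGenerator_ne_zero`), and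
`consistency_iff_nonDeficient_and_deficientVanishing`. Nothing is asserted about any item or child; all
enter as explicit hypotheses, spelled out verbatim (the children are not yet route decls).

References: Mazur–Tate–Teitelbaum, Invent. Math. 84 (1986) §I.14, §II.10; Perrin-Riou, Invent. Math. 89
(1987) §1.4; Kato, Astérisque 295 (2004) Thm 18.4; Burns–Kurihara–Sano arXiv:1910.07404 Conj. 1.1,
Cor. 1.10; arXiv:2103.11535 p. 2.
-/

set_option linter.dupNamespace false

namespace Summit.BirchSwinnertonDyer.BirchSwinnertonDyer.Theorems

open scoped MatrixGroups ModularForm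
open CongruenceSubgroup Literature.NumberTheory.EllipticCurves
  Literature.NumberTheory.EllipticCurves.ModularForms WeierstrassCurve
open Summit.BirchSwinnertonDyer.BirchSwinnertonDyer.Theses.LeadingTerm (Consistency PinchPrime SqueezeUBR2
  RankLeOne KatoCorankBound)
open Summit.BirchSwinnertonDyer.BirchSwinnertonDyer.Theses.SelmerRank (SelmerRankLB SelmerRankSmallImage)

/-! ### The glue: children → crux (the `--glue-by` theorem) -/

/-- **`Consistency` from its two children** — (A) `ConsistencyNonDeficient` (the crux on the cells
`r_an ≤ r_MW`) and (B) `DeficientVanishing` (`r_MW < r_an ⇒ [T^{r_MW}]L_p(f,α_p,T) = 0`): case split on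
`r_an ≤ r_MW`; in a deficient cell both identities hold with `q = 0` (`consistencyAt_of_coeff_eq_zero`:
`L^{(r_MW)}(E,1) = 0` below the analytic order, `Reg_∞ > 0`, `Ω⁺_f > 0` tree theorems). Colon form,
children spelled out verbatim. [folklore] -/
theorem consistency_of_nonDeficient_of_deficientVanishing :
    (∀ (W : WeierstrassCurve ℚ) [W.IsElliptic] [W.IsGloballyMinimal] (p : ℕ) [Fact p.Prime],
      5 ≤ p → Literature.NumberTheory.EllipticCurves.IsOrdinaryAt W p →
      ∀ (D : WeierstrassCurve.PAdicHeightData W p), D.IsCanonical →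
      ∀ ⦃N : ℕ⦄ [NeZero N] (f : CuspForm (CongruenceSubgroup.Gamma0 N) 2),
        Literature.NumberTheory.EllipticCurves.ModularForms.IsNewformOf W f →
        W.analyticRank ≤ W.mordellWeilRank →
          0 < W.regulator ∧ 0 < Literature.NumberTheory.EllipticCurves.ModularForms.plusPeriod f ∧
          ∃ q : ℚ, iteratedDeriv W.mordellWeilRank W.entireLFunction 1 =
              (((W.mordellWeilRank.factorial : ℝ) * (q : ℝ) *
                Literature.NumberTheory.EllipticCurves.ModularForms.plusPeriod f * W.regulator : ℝ) : ℂ) ∧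
            PowerSeries.coeff W.mordellWeilRank
                (Literature.NumberTheory.EllipticCurves.padicLFunction f
                  (Literature.NumberTheory.EllipticCurves.unitRoot W p : ℚ_[p])) *
                Literature.NumberTheory.EllipticCurves.padicLog p
                  (Literature.NumberTheory.EllipticCurves.cyclotomicGenerator p) ^ W.mordellWeilRank =
              (q : ℚ_[p]) * (1 - (Literature.NumberTheory.EllipticCurves.unitRoot W p : ℚ_[p])⁻¹) ^ 2 *
                WeierstrassCurve.padicRegulator D) →
    (∀ (W : WeierstrassCurve ℚ) [W.IsElliptic] [W.IsGloballyMinimal] (p : ℕ) [Fact p.Prime],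
      5 ≤ p → Literature.NumberTheory.EllipticCurves.IsOrdinaryAt W p →
      ∀ ⦃N : ℕ⦄ [NeZero N] (f : CuspForm (CongruenceSubgroup.Gamma0 N) 2),
        Literature.NumberTheory.EllipticCurves.ModularForms.IsNewformOf W f →
        W.mordellWeilRank < W.analyticRank →
          PowerSeries.coeff W.mordellWeilRank
            (Literature.NumberTheory.EllipticCurves.padicLFunction f
              (Literature.NumberTheory.EllipticCurves.unitRoot W p : ℚ_[p])) = 0) →
    Summit.BirchSwinnertonDyer.BirchSwinnertonDyer.Theses.LeadingTerm.Consistency := by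
  intro hA hB W _ _ p _ h5 hord D hD N _ f hf
  rcases le_or_gt W.analyticRank W.mordellWeilRank with hle | hlt
  · exact hA W p h5 hord D hD f hf hle
  · exact consistencyAt_of_coeff_eq_zero W p D f hf hlt (hB W p h5 hord f hf hlt)

/-! ### No child is stronger than the crux: both are restrictions -/

/-- **`Consistency → ConsistencyNonDeficient`** (restriction to the cells `r_an ≤ r_MW`). [folklore] -/
theorem nonDeficient_of_consistency :
    Summit.BirchSwinnertonDyer.BirchSwinnertonDyer.Theses.LeadingTerm.Consistency →
    ∀ (W : WeierstrassCurve ℚ) [W.IsElliptic] [W.IsGloballyMinimal] (p : ℕ) [Fact p.Prime],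
      5 ≤ p → Literature.NumberTheory.EllipticCurves.IsOrdinaryAt W p →
      ∀ (D : WeierstrassCurve.PAdicHeightData W p), D.IsCanonical →
      ∀ ⦃N : ℕ⦄ [NeZero N] (f : CuspForm (CongruenceSubgroup.Gamma0 N) 2),
        Literature.NumberTheory.EllipticCurves.ModularForms.IsNewformOf W f →
        W.analyticRank ≤ W.mordellWeilRank →
          0 < W.regulator ∧ 0 < Literature.NumberTheory.EllipticCurves.ModularForms.plusPeriod f ∧
          ∃ q : ℚ, iteratedDeriv W.mordellWeilRank W.entireLFunction 1 =
              (((W.mordellWeilRank.factorial : ℝ) * (q : ℝ) *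
                Literature.NumberTheory.EllipticCurves.ModularForms.plusPeriod f * W.regulator : ℝ) : ℂ) ∧
            PowerSeries.coeff W.mordellWeilRank
                (Literature.NumberTheory.EllipticCurves.padicLFunction f
                  (Literature.NumberTheory.EllipticCurves.unitRoot W p : ℚ_[p])) *
                Literature.NumberTheory.EllipticCurves.padicLog p
                  (Literature.NumberTheory.EllipticCurves.cyclotomicGenerator p) ^ W.mordellWeilRank =
              (q : ℚ_[p]) * (1 - (Literature.NumberTheory.EllipticCurves.unitRoot W p : ℚ_[p])⁻¹) ^ 2 *
                WeierstrassCurve.padicRegulator D :=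
  fun hC W _ _ p _ h5 hord D hD _ _ f hf _ => hC W p h5 hord D hD f hf

/-- **`Consistency → DeficientVanishing`**: in a deficient cell `r_MW < r_an` instantiate the crux at the
canonical datum (it exists: `exists_isCanonical_holds`, Mazur–Tate / Schneider σ-height); the archimedean
identity forces `q = 0` (`L^{(r_MW)}(E,1) = 0`, `r!·Ω⁺_f·Reg_∞ ≠ 0`), so `[T^{r_MW}]L_p · log_p(γ)^{r_MW} = 0`,
and `log_p γ ≠ 0` (`leadingTerm_padicLog_cyclotomicGenerator_ne_zero`). [folklore] -/
theorem deficientVanishing_of_consistency :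
    Summit.BirchSwinnertonDyer.BirchSwinnertonDyer.Theses.LeadingTerm.Consistency →
    ∀ (W : WeierstrassCurve ℚ) [W.IsElliptic] [W.IsGloballyMinimal] (p : ℕ) [Fact p.Prime],
      5 ≤ p → Literature.NumberTheory.EllipticCurves.IsOrdinaryAt W p →
      ∀ ⦃N : ℕ⦄ [NeZero N] (f : CuspForm (CongruenceSubgroup.Gamma0 N) 2),
        Literature.NumberTheory.EllipticCurves.ModularForms.IsNewformOf W f →
        W.mordellWeilRank < W.analyticRank →
          PowerSeries.coeff W.mordellWeilRank
            (Literature.NumberTheory.EllipticCurves.padicLFunction f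
              (Literature.NumberTheory.EllipticCurves.unitRoot W p : ℚ_[p])) = 0 := by
  intro hC W _ _ p _ h5 hord N _ f hf hlt
  obtain ⟨D, hD⟩ := exists_isCanonical_holds W p h5 hord.1 hord.2
  obtain ⟨hreg, hΩ, q, hA, hP⟩ := hC W p h5 hord D hD f hf
  have hL : iteratedDeriv W.mordellWeilRank W.entireLFunction 1 = 0 :=
    iteratedDeriv_entireLFunction_eq_zero_of_lt_analyticRank W hlt
  have hq : q = 0 := by
    rw [hL] at hA
    have hfac : (0 : ℝ) < W.mordellWeilRank.factorial := by exact_mod_cast Nat.factorial_pos _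
    have h : ((W.mordellWeilRank.factorial : ℝ) * (q : ℝ) * plusPeriod f * W.regulator : ℝ) = 0 := by
      exact_mod_cast hA.symm
    have hne : (W.mordellWeilRank.factorial : ℝ) * plusPeriod f * W.regulator ≠ 0 :=
      mul_ne_zero (mul_ne_zero hfac.ne' hΩ.ne') hreg.ne'
    have : (q : ℝ) * ((W.mordellWeilRank.factorial : ℝ) * plusPeriod f * W.regulator) = 0 := by
      linear_combination h
    exact_mod_cast (mul_eq_zero.mp this).resolve_right hne
  subst hq
  have h0 : PowerSeries.coeff W.mordellWeilRank (padicLFunction f (unitRoot W p : ℚ_[p])) *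
      padicLog p (cyclotomicGenerator p) ^ W.mordellWeilRank = 0 := by
    rw [hP]; push_cast; ring
  exact (mul_eq_zero.mp h0).resolve_right
    (pow_ne_zero _ (leadingTerm_padicLog_cyclotomicGenerator_ne_zero p))

/-- **The split is EXACT**: `Consistency ↔ ConsistencyNonDeficient ∧ DeficientVanishing`, with no item as
hypothesis. [folklore] -/
theorem consistency_iff_nonDeficient_and_deficientVanishing :
    Summit.BirchSwinnertonDyer.BirchSwinnertonDyer.Theses.LeadingTerm.Consistency ↔
    ((∀ (W : WeierstrassCurve ℚ) [W.IsElliptic] [W.IsGloballyMinimal] (p : ℕ) [Fact p.Prime],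
      5 ≤ p → Literature.NumberTheory.EllipticCurves.IsOrdinaryAt W p →
      ∀ (D : WeierstrassCurve.PAdicHeightData W p), D.IsCanonical →
      ∀ ⦃N : ℕ⦄ [NeZero N] (f : CuspForm (CongruenceSubgroup.Gamma0 N) 2),
        Literature.NumberTheory.EllipticCurves.ModularForms.IsNewformOf W f →
        W.analyticRank ≤ W.mordellWeilRank →
          0 < W.regulator ∧ 0 < Literature.NumberTheory.EllipticCurves.ModularForms.plusPeriod f ∧
          ∃ q : ℚ, iteratedDeriv W.mordellWeilRank W.entireLFunction 1 =
              (((W.mordellWeilRank.factorial : ℝ) * (q : ℝ) *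
                Literature.NumberTheory.EllipticCurves.ModularForms.plusPeriod f * W.regulator : ℝ) : ℂ) ∧
            PowerSeries.coeff W.mordellWeilRank
                (Literature.NumberTheory.EllipticCurves.padicLFunction f
                  (Literature.NumberTheory.EllipticCurves.unitRoot W p : ℚ_[p])) *
                Literature.NumberTheory.EllipticCurves.padicLog p
                  (Literature.NumberTheory.EllipticCurves.cyclotomicGenerator p) ^ W.mordellWeilRank =
              (q : ℚ_[p]) * (1 - (Literature.NumberTheory.EllipticCurves.unitRoot W p : ℚ_[p])⁻¹) ^ 2 *
                WeierstrassCurve.padicRegulator D) ∧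
     (∀ (W : WeierstrassCurve ℚ) [W.IsElliptic] [W.IsGloballyMinimal] (p : ℕ) [Fact p.Prime],
      5 ≤ p → Literature.NumberTheory.EllipticCurves.IsOrdinaryAt W p →
      ∀ ⦃N : ℕ⦄ [NeZero N] (f : CuspForm (CongruenceSubgroup.Gamma0 N) 2),
        Literature.NumberTheory.EllipticCurves.ModularForms.IsNewformOf W f →
        W.mordellWeilRank < W.analyticRank →
          PowerSeries.coeff W.mordellWeilRank
            (Literature.NumberTheory.EllipticCurves.padicLFunction f
              (Literature.NumberTheory.EllipticCurves.unitRoot W p : ℚ_[p])) = 0)) :=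
  ⟨fun hC => ⟨nonDeficient_of_consistency hC, deficientVanishing_of_consistency hC⟩,
    fun h => consistency_of_nonDeficient_of_deficientVanishing h.1 h.2⟩

/-! ### Child B is the load-bearing, within-summit piece -/

/-- **The deciding theorem re-glued on child B**: `DeficientVanishing → PinchPrime → SqueezeUBR2 →
BirchSwinnertonDyer` — the landed `bsd_of_pinchPrime_of_deficientVanishing` (p135377) with child B's exact
spelling; a tenure `--closes-file` can take `closes (hDV : DeficientVanishing) (hP : PinchPrime)
(hUB : SqueezeUBR2) := Theorems.bsd_of_deficientVanishing_of_pinchPrime_of_squeezeUB hDV hP hUB`. [folklore] -/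
theorem bsd_of_deficientVanishing_of_pinchPrime_of_squeezeUB :
    (∀ (W : WeierstrassCurve ℚ) [W.IsElliptic] [W.IsGloballyMinimal] (p : ℕ) [Fact p.Prime],
      5 ≤ p → Literature.NumberTheory.EllipticCurves.IsOrdinaryAt W p →
      ∀ ⦃N : ℕ⦄ [NeZero N] (f : CuspForm (CongruenceSubgroup.Gamma0 N) 2),
        Literature.NumberTheory.EllipticCurves.ModularForms.IsNewformOf W f →
        W.mordellWeilRank < W.analyticRank →
          PowerSeries.coeff W.mordellWeilRank
            (Literature.NumberTheory.EllipticCurves.padicLFunction f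
              (Literature.NumberTheory.EllipticCurves.unitRoot W p : ℚ_[p])) = 0) →
    Summit.BirchSwinnertonDyer.BirchSwinnertonDyer.Theses.LeadingTerm.PinchPrime →
    Summit.BirchSwinnertonDyer.BirchSwinnertonDyer.Theses.LeadingTerm.SqueezeUBR2 →
    _root_.BirchSwinnertonDyer :=
  fun hB hP hUB => bsd_of_pinchPrime_of_deficientVanishing hB hP hUB

/-- **Child B is WITHIN the summit**: BSD-rank makes every deficient cell empty, so `DeficientVanishing`
follows from `BirchSwinnertonDyer` (informational `S → B`; contrast child A, which contains BSD-rationality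
in rank `≥ 2`, not a consequence of BSD-rank). [folklore] -/
theorem deficientVanishing_of_bsd :
    _root_.BirchSwinnertonDyer →
    ∀ (W : WeierstrassCurve ℚ) [W.IsElliptic] [W.IsGloballyMinimal] (p : ℕ) [Fact p.Prime],
      5 ≤ p → Literature.NumberTheory.EllipticCurves.IsOrdinaryAt W p →
      ∀ ⦃N : ℕ⦄ [NeZero N] (f : CuspForm (CongruenceSubgroup.Gamma0 N) 2),
        Literature.NumberTheory.EllipticCurves.ModularForms.IsNewformOf W f →
        W.mordellWeilRank < W.analyticRank →
          PowerSeries.coeff W.mordellWeilRank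
            (Literature.NumberTheory.EllipticCurves.padicLFunction f
              (Literature.NumberTheory.EllipticCurves.unitRoot W p : ℚ_[p])) = 0 := by
  intro h W hW _ p _ _ _ N _ f _ hlt
  have h' : ∀ V : WeierstrassCurve ℚ, V.IsElliptic → V.analyticRank = V.mordellWeilRank := h
  have := h' W hW
  omega

/-- **Child B is closed MODULO ITEMS**: `KatoCorankBound` (support, stmt-18048: Kato Thm 18.4, corank
form) with route SelmerRank's `SelmerRankLB` (stmt-0131) and `SelmerRankSmallImage` (stmt-14418) give
`DeficientVanishing` (`r_MW < r_an ≤ corank Sel_{p^∞} ≤ ord_T L_p` for `r_MW ≥ 1`, interpolation for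
`r_MW = 0`; = the landed `deficientVanishing_of_items`). [cite: Kato2004Asterisque, Thm 18.4 (p. 281)] -/
theorem deficientVanishing_of_katoCorankBound_of_selmerRankItems :
    Summit.BirchSwinnertonDyer.BirchSwinnertonDyer.Theses.LeadingTerm.KatoCorankBound →
    Summit.BirchSwinnertonDyer.BirchSwinnertonDyer.Theses.SelmerRank.SelmerRankLB →
    Summit.BirchSwinnertonDyer.BirchSwinnertonDyer.Theses.SelmerRank.SelmerRankSmallImage →
    ∀ (W : WeierstrassCurve ℚ) [W.IsElliptic] [W.IsGloballyMinimal] (p : ℕ) [Fact p.Prime],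
      5 ≤ p → Literature.NumberTheory.EllipticCurves.IsOrdinaryAt W p →
      ∀ ⦃N : ℕ⦄ [NeZero N] (f : CuspForm (CongruenceSubgroup.Gamma0 N) 2),
        Literature.NumberTheory.EllipticCurves.ModularForms.IsNewformOf W f →
        W.mordellWeilRank < W.analyticRank →
          PowerSeries.coeff W.mordellWeilRank
            (Literature.NumberTheory.EllipticCurves.padicLFunction f
              (Literature.NumberTheory.EllipticCurves.unitRoot W p : ℚ_[p])) = 0 :=
  fun hKC hLB hSI => deficientVanishing_of_items hLB hSI hKC

/-! ### Child A is the diagonal `p`-adic Beilinson identity: modulo items it is S2 = (R) ∧ (T) -/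

/-- **`ConsistencyNonDeficient → S2`** (restriction to the diagonal `r_MW = r_an ≥ 2`; S2 = the registered
stub `stub_diagonal_two_le` of line `Sketch` verbatim). [folklore] -/
theorem diagonalTwoLe_of_nonDeficient :
    (∀ (W : WeierstrassCurve ℚ) [W.IsElliptic] [W.IsGloballyMinimal] (p : ℕ) [Fact p.Prime],
      5 ≤ p → Literature.NumberTheory.EllipticCurves.IsOrdinaryAt W p →
      ∀ (D : WeierstrassCurve.PAdicHeightData W p), D.IsCanonical →
      ∀ ⦃N : ℕ⦄ [NeZero N] (f : CuspForm (CongruenceSubgroup.Gamma0 N) 2),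
        Literature.NumberTheory.EllipticCurves.ModularForms.IsNewformOf W f →
        W.analyticRank ≤ W.mordellWeilRank →
          0 < W.regulator ∧ 0 < Literature.NumberTheory.EllipticCurves.ModularForms.plusPeriod f ∧
          ∃ q : ℚ, iteratedDeriv W.mordellWeilRank W.entireLFunction 1 =
              (((W.mordellWeilRank.factorial : ℝ) * (q : ℝ) *
                Literature.NumberTheory.EllipticCurves.ModularForms.plusPeriod f * W.regulator : ℝ) : ℂ) ∧
            PowerSeries.coeff W.mordellWeilRank
                (Literature.NumberTheory.EllipticCurves.padicLFunction f
                  (Literature.NumberTheory.EllipticCurves.unitRoot W p : ℚ_[p])) *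
                Literature.NumberTheory.EllipticCurves.padicLog p
                  (Literature.NumberTheory.EllipticCurves.cyclotomicGenerator p) ^ W.mordellWeilRank =
              (q : ℚ_[p]) * (1 - (Literature.NumberTheory.EllipticCurves.unitRoot W p : ℚ_[p])⁻¹) ^ 2 *
                WeierstrassCurve.padicRegulator D) →
    ∀ (W : WeierstrassCurve ℚ) [W.IsElliptic] [W.IsGloballyMinimal] (p : ℕ) [Fact p.Prime],
      5 ≤ p → Literature.NumberTheory.EllipticCurves.IsOrdinaryAt W p →
      ∀ (D : WeierstrassCurve.PAdicHeightData W p), D.IsCanonical →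
      ∀ ⦃N : ℕ⦄ [NeZero N] (f : CuspForm (CongruenceSubgroup.Gamma0 N) 2),
        Literature.NumberTheory.EllipticCurves.ModularForms.IsNewformOf W f →
        2 ≤ W.mordellWeilRank → W.analyticRank = W.mordellWeilRank →
          0 < W.regulator ∧ 0 < Literature.NumberTheory.EllipticCurves.ModularForms.plusPeriod f ∧
          ∃ q : ℚ, iteratedDeriv W.mordellWeilRank W.entireLFunction 1 =
              (((W.mordellWeilRank.factorial : ℝ) * (q : ℝ) *
                Literature.NumberTheory.EllipticCurves.ModularForms.plusPeriod f * W.regulator : ℝ) : ℂ) ∧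
            PowerSeries.coeff W.mordellWeilRank
                (Literature.NumberTheory.EllipticCurves.padicLFunction f
                  (Literature.NumberTheory.EllipticCurves.unitRoot W p : ℚ_[p])) *
                Literature.NumberTheory.EllipticCurves.padicLog p
                  (Literature.NumberTheory.EllipticCurves.cyclotomicGenerator p) ^ W.mordellWeilRank =
              (q : ℚ_[p]) * (1 - (Literature.NumberTheory.EllipticCurves.unitRoot W p : ℚ_[p])⁻¹) ^ 2 *
                WeierstrassCurve.padicRegulator D :=
  fun hA W _ _ p _ h5 hord D hD _ _ f hf _ heq => hA W p h5 hord D hD f hf heq.le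

/-- **S2 → `ConsistencyNonDeficient` modulo the items `SqueezeUBR2` (crux #4) and `RankLeOne` (support)**:
no excess cells (`SqueezeUBR2`), so `r_an ≤ r_MW` is the diagonal; there `r = 0` is the tree theorem
`leadingTerm_consistency_of_rank_zero`, `r = 1` is `RankLeOne`, `r ≥ 2` is S2.
[cite: MazurTateTeitelbaum1986Invent, §I.14 (14.3)] -/
theorem nonDeficient_of_diagonalTwoLe_of_items :
    (∀ (W : WeierstrassCurve ℚ) [W.IsElliptic] [W.IsGloballyMinimal] (p : ℕ) [Fact p.Prime],
      5 ≤ p → Literature.NumberTheory.EllipticCurves.IsOrdinaryAt W p →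
      ∀ (D : WeierstrassCurve.PAdicHeightData W p), D.IsCanonical →
      ∀ ⦃N : ℕ⦄ [NeZero N] (f : CuspForm (CongruenceSubgroup.Gamma0 N) 2),
        Literature.NumberTheory.EllipticCurves.ModularForms.IsNewformOf W f →
        2 ≤ W.mordellWeilRank → W.analyticRank = W.mordellWeilRank →
          0 < W.regulator ∧ 0 < Literature.NumberTheory.EllipticCurves.ModularForms.plusPeriod f ∧
          ∃ q : ℚ, iteratedDeriv W.mordellWeilRank W.entireLFunction 1 =
              (((W.mordellWeilRank.factorial : ℝ) * (q : ℝ) *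
                Literature.NumberTheory.EllipticCurves.ModularForms.plusPeriod f * W.regulator : ℝ) : ℂ) ∧
            PowerSeries.coeff W.mordellWeilRank
                (Literature.NumberTheory.EllipticCurves.padicLFunction f
                  (Literature.NumberTheory.EllipticCurves.unitRoot W p : ℚ_[p])) *
                Literature.NumberTheory.EllipticCurves.padicLog p
                  (Literature.NumberTheory.EllipticCurves.cyclotomicGenerator p) ^ W.mordellWeilRank =
              (q : ℚ_[p]) * (1 - (Literature.NumberTheory.EllipticCurves.unitRoot W p : ℚ_[p])⁻¹) ^ 2 *
                WeierstrassCurve.padicRegulator D) →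
    Summit.BirchSwinnertonDyer.BirchSwinnertonDyer.Theses.LeadingTerm.SqueezeUBR2 →
    Summit.BirchSwinnertonDyer.BirchSwinnertonDyer.Theses.LeadingTerm.RankLeOne →
    ∀ (W : WeierstrassCurve ℚ) [W.IsElliptic] [W.IsGloballyMinimal] (p : ℕ) [Fact p.Prime],
      5 ≤ p → Literature.NumberTheory.EllipticCurves.IsOrdinaryAt W p →
      ∀ (D : WeierstrassCurve.PAdicHeightData W p), D.IsCanonical →
      ∀ ⦃N : ℕ⦄ [NeZero N] (f : CuspForm (CongruenceSubgroup.Gamma0 N) 2),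
        Literature.NumberTheory.EllipticCurves.ModularForms.IsNewformOf W f →
        W.analyticRank ≤ W.mordellWeilRank →
          0 < W.regulator ∧ 0 < Literature.NumberTheory.EllipticCurves.ModularForms.plusPeriod f ∧
          ∃ q : ℚ, iteratedDeriv W.mordellWeilRank W.entireLFunction 1 =
              (((W.mordellWeilRank.factorial : ℝ) * (q : ℝ) *
                Literature.NumberTheory.EllipticCurves.ModularForms.plusPeriod f * W.regulator : ℝ) : ℂ) ∧
            PowerSeries.coeff W.mordellWeilRank
                (Literature.NumberTheory.EllipticCurves.padicLFunction f
                  (Literature.NumberTheory.EllipticCurves.unitRoot W p : ℚ_[p])) *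
                Literature.NumberTheory.EllipticCurves.padicLog p
                  (Literature.NumberTheory.EllipticCurves.cyclotomicGenerator p) ^ W.mordellWeilRank =
              (q : ℚ_[p]) * (1 - (Literature.NumberTheory.EllipticCurves.unitRoot W p : ℚ_[p])⁻¹) ^ 2 *
                WeierstrassCurve.padicRegulator D := by
  intro hS2 hUB hR1 W _ _ p _ h5 hord D hD N _ f hf hle
  have heq : W.analyticRank = W.mordellWeilRank := le_antisymm hle (hUB W)
  rcases Nat.eq_zero_or_pos W.mordellWeilRank with h0 | hpos
  · exact leadingTerm_consistency_of_rank_zero W p hord h0 D f hf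
  · by_cases h1 : W.mordellWeilRank = 1
    · exact hR1 W p h5 hord h1.le heq D hD f hf
    · exact hS2 W p h5 hord D hD f hf (by omega) heq

/-- **Modulo `SqueezeUBR2` and `RankLeOne`, child A is EQUIVALENT to S2** (the residual stub of lines
`Sketch` / `birth`). [folklore] -/
theorem nonDeficient_iff_diagonalTwoLe_of_items :
    Summit.BirchSwinnertonDyer.BirchSwinnertonDyer.Theses.LeadingTerm.SqueezeUBR2 →
    Summit.BirchSwinnertonDyer.BirchSwinnertonDyer.Theses.LeadingTerm.RankLeOne →
    ((∀ (W : WeierstrassCurve ℚ) [W.IsElliptic] [W.IsGloballyMinimal] (p : ℕ) [Fact p.Prime],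
      5 ≤ p → Literature.NumberTheory.EllipticCurves.IsOrdinaryAt W p →
      ∀ (D : WeierstrassCurve.PAdicHeightData W p), D.IsCanonical →
      ∀ ⦃N : ℕ⦄ [NeZero N] (f : CuspForm (CongruenceSubgroup.Gamma0 N) 2),
        Literature.NumberTheory.EllipticCurves.ModularForms.IsNewformOf W f →
        W.analyticRank ≤ W.mordellWeilRank →
          0 < W.regulator ∧ 0 < Literature.NumberTheory.EllipticCurves.ModularForms.plusPeriod f ∧
          ∃ q : ℚ, iteratedDeriv W.mordellWeilRank W.entireLFunction 1 =
              (((W.mordellWeilRank.factorial : ℝ) * (q : ℝ) *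
                Literature.NumberTheory.EllipticCurves.ModularForms.plusPeriod f * W.regulator : ℝ) : ℂ) ∧
            PowerSeries.coeff W.mordellWeilRank
                (Literature.NumberTheory.EllipticCurves.padicLFunction f
                  (Literature.NumberTheory.EllipticCurves.unitRoot W p : ℚ_[p])) *
                Literature.NumberTheory.EllipticCurves.padicLog p
                  (Literature.NumberTheory.EllipticCurves.cyclotomicGenerator p) ^ W.mordellWeilRank =
              (q : ℚ_[p]) * (1 - (Literature.NumberTheory.EllipticCurves.unitRoot W p : ℚ_[p])⁻¹) ^ 2 *
                WeierstrassCurve.padicRegulator D) ↔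
     (∀ (W : WeierstrassCurve ℚ) [W.IsElliptic] [W.IsGloballyMinimal] (p : ℕ) [Fact p.Prime],
      5 ≤ p → Literature.NumberTheory.EllipticCurves.IsOrdinaryAt W p →
      ∀ (D : WeierstrassCurve.PAdicHeightData W p), D.IsCanonical →
      ∀ ⦃N : ℕ⦄ [NeZero N] (f : CuspForm (CongruenceSubgroup.Gamma0 N) 2),
        Literature.NumberTheory.EllipticCurves.ModularForms.IsNewformOf W f →
        2 ≤ W.mordellWeilRank → W.analyticRank = W.mordellWeilRank →
          0 < W.regulator ∧ 0 < Literature.NumberTheory.EllipticCurves.ModularForms.plusPeriod f ∧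
          ∃ q : ℚ, iteratedDeriv W.mordellWeilRank W.entireLFunction 1 =
              (((W.mordellWeilRank.factorial : ℝ) * (q : ℝ) *
                Literature.NumberTheory.EllipticCurves.ModularForms.plusPeriod f * W.regulator : ℝ) : ℂ) ∧
            PowerSeries.coeff W.mordellWeilRank
                (Literature.NumberTheory.EllipticCurves.padicLFunction f
                  (Literature.NumberTheory.EllipticCurves.unitRoot W p : ℚ_[p])) *
                Literature.NumberTheory.EllipticCurves.padicLog p
                  (Literature.NumberTheory.EllipticCurves.cyclotomicGenerator p) ^ W.mordellWeilRank =
              (q : ℚ_[p]) * (1 - (Literature.NumberTheory.EllipticCurves.unitRoot W p : ℚ_[p])⁻¹) ^ 2 *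
                WeierstrassCurve.padicRegulator D)) :=
  fun hUB hR1 => ⟨fun hA => diagonalTwoLe_of_nonDeficient hA,
    fun hS2 => nonDeficient_of_diagonalTwoLe_of_items hS2 hUB hR1⟩

/-- **Child A contains BSD-RATIONALITY at the rank** (archimedean, `p`-free; refined-BSD content beyond the
summit): for `r_MW = r_an ≥ 2` and the newform `f` of `E`, `L^{(r)}(E,1) ∈ ℚ · r! · Ω⁺_f · Reg_∞(E)` — via
`diagonalTwoLe_of_nonDeficient` and the landed `diagonalTwoLe_iff_rationality_and_transfer` (p134366; a good
ordinary `p ≥ 5` and a canonical datum always exist). [cite: arXiv:1910.07404, Conj. 1.1] -/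
theorem rationality_of_nonDeficient :
    (∀ (W : WeierstrassCurve ℚ) [W.IsElliptic] [W.IsGloballyMinimal] (p : ℕ) [Fact p.Prime],
      5 ≤ p → Literature.NumberTheory.EllipticCurves.IsOrdinaryAt W p →
      ∀ (D : WeierstrassCurve.PAdicHeightData W p), D.IsCanonical →
      ∀ ⦃N : ℕ⦄ [NeZero N] (f : CuspForm (CongruenceSubgroup.Gamma0 N) 2),
        Literature.NumberTheory.EllipticCurves.ModularForms.IsNewformOf W f →
        W.analyticRank ≤ W.mordellWeilRank →
          0 < W.regulator ∧ 0 < Literature.NumberTheory.EllipticCurves.ModularForms.plusPeriod f ∧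
          ∃ q : ℚ, iteratedDeriv W.mordellWeilRank W.entireLFunction 1 =
              (((W.mordellWeilRank.factorial : ℝ) * (q : ℝ) *
                Literature.NumberTheory.EllipticCurves.ModularForms.plusPeriod f * W.regulator : ℝ) : ℂ) ∧
            PowerSeries.coeff W.mordellWeilRank
                (Literature.NumberTheory.EllipticCurves.padicLFunction f
                  (Literature.NumberTheory.EllipticCurves.unitRoot W p : ℚ_[p])) *
                Literature.NumberTheory.EllipticCurves.padicLog p
                  (Literature.NumberTheory.EllipticCurves.cyclotomicGenerator p) ^ W.mordellWeilRank =
              (q : ℚ_[p]) * (1 - (Literature.NumberTheory.EllipticCurves.unitRoot W p : ℚ_[p])⁻¹) ^ 2 *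
                WeierstrassCurve.padicRegulator D) →
    ∀ (W : WeierstrassCurve ℚ) [W.IsElliptic] [W.IsGloballyMinimal]
      ⦃N : ℕ⦄ [NeZero N] (f : CuspForm (CongruenceSubgroup.Gamma0 N) 2),
      Literature.NumberTheory.EllipticCurves.ModularForms.IsNewformOf W f →
      2 ≤ W.mordellWeilRank → W.analyticRank = W.mordellWeilRank →
        ∃ q : ℚ, iteratedDeriv W.mordellWeilRank W.entireLFunction 1 =
          (((W.mordellWeilRank.factorial : ℝ) * (q : ℝ) *
            Literature.NumberTheory.EllipticCurves.ModularForms.plusPeriod f * W.regulator : ℝ) : ℂ) :=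
  fun hA => (diagonalTwoLe_iff_rationality_and_transfer.mp (diagonalTwoLe_of_nonDeficient hA)).1

/-- **Conversely (R) ∧ (T) give child A modulo `SqueezeUBR2` and `RankLeOne`** — so the two stubs of line
`birth` (`stub_rationality`, `stub_transfer`) are a skeleton of child A as well. [folklore] -/
theorem nonDeficient_of_rationality_of_transfer_of_items :
    (∀ (W : WeierstrassCurve ℚ) [W.IsElliptic] [W.IsGloballyMinimal]
        ⦃N : ℕ⦄ [NeZero N] (f : CuspForm (CongruenceSubgroup.Gamma0 N) 2),
        Literature.NumberTheory.EllipticCurves.ModularForms.IsNewformOf W f →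
        2 ≤ W.mordellWeilRank → W.analyticRank = W.mordellWeilRank →
          ∃ q : ℚ, iteratedDeriv W.mordellWeilRank W.entireLFunction 1 =
            (((W.mordellWeilRank.factorial : ℝ) * (q : ℝ) *
              Literature.NumberTheory.EllipticCurves.ModularForms.plusPeriod f * W.regulator : ℝ) : ℂ)) →
    (∀ (W : WeierstrassCurve ℚ) [W.IsElliptic] [W.IsGloballyMinimal] (p : ℕ) [Fact p.Prime],
      5 ≤ p → Literature.NumberTheory.EllipticCurves.IsOrdinaryAt W p →
      ∀ (D : WeierstrassCurve.PAdicHeightData W p), D.IsCanonical →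
      ∀ ⦃N : ℕ⦄ [NeZero N] (f : CuspForm (CongruenceSubgroup.Gamma0 N) 2),
        Literature.NumberTheory.EllipticCurves.ModularForms.IsNewformOf W f →
        2 ≤ W.mordellWeilRank → W.analyticRank = W.mordellWeilRank → ∀ q : ℚ,
          iteratedDeriv W.mordellWeilRank W.entireLFunction 1 =
              (((W.mordellWeilRank.factorial : ℝ) * (q : ℝ) *
                Literature.NumberTheory.EllipticCurves.ModularForms.plusPeriod f * W.regulator : ℝ) : ℂ) →
            PowerSeries.coeff W.mordellWeilRank
                (Literature.NumberTheory.EllipticCurves.padicLFunction f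
                  (Literature.NumberTheory.EllipticCurves.unitRoot W p : ℚ_[p])) *
                Literature.NumberTheory.EllipticCurves.padicLog p
                  (Literature.NumberTheory.EllipticCurves.cyclotomicGenerator p) ^ W.mordellWeilRank =
              (q : ℚ_[p]) * (1 - (Literature.NumberTheory.EllipticCurves.unitRoot W p : ℚ_[p])⁻¹) ^ 2 *
                WeierstrassCurve.padicRegulator D) →
    Summit.BirchSwinnertonDyer.BirchSwinnertonDyer.Theses.LeadingTerm.SqueezeUBR2 →
    Summit.BirchSwinnertonDyer.BirchSwinnertonDyer.Theses.LeadingTerm.RankLeOne →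
    ∀ (W : WeierstrassCurve ℚ) [W.IsElliptic] [W.IsGloballyMinimal] (p : ℕ) [Fact p.Prime],
      5 ≤ p → Literature.NumberTheory.EllipticCurves.IsOrdinaryAt W p →
      ∀ (D : WeierstrassCurve.PAdicHeightData W p), D.IsCanonical →
      ∀ ⦃N : ℕ⦄ [NeZero N] (f : CuspForm (CongruenceSubgroup.Gamma0 N) 2),
        Literature.NumberTheory.EllipticCurves.ModularForms.IsNewformOf W f →
        W.analyticRank ≤ W.mordellWeilRank →
          0 < W.regulator ∧ 0 < Literature.NumberTheory.EllipticCurves.ModularForms.plusPeriod f ∧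
          ∃ q : ℚ, iteratedDeriv W.mordellWeilRank W.entireLFunction 1 =
              (((W.mordellWeilRank.factorial : ℝ) * (q : ℝ) *
                Literature.NumberTheory.EllipticCurves.ModularForms.plusPeriod f * W.regulator : ℝ) : ℂ) ∧
            PowerSeries.coeff W.mordellWeilRank
                (Literature.NumberTheory.EllipticCurves.padicLFunction f
                  (Literature.NumberTheory.EllipticCurves.unitRoot W p : ℚ_[p])) *
                Literature.NumberTheory.EllipticCurves.padicLog p
                  (Literature.NumberTheory.EllipticCurves.cyclotomicGenerator p) ^ W.mordellWeilRank =
              (q : ℚ_[p]) * (1 - (Literature.NumberTheory.EllipticCurves.unitRoot W p : ℚ_[p])⁻¹) ^ 2 *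
                WeierstrassCurve.padicRegulator D :=
  fun hR hT hUB hR1 => nonDeficient_of_diagonalTwoLe_of_items
    (diagonalTwoLe_iff_rationality_and_transfer.mpr ⟨hR, hT⟩) hUB hR1

end Summit.BirchSwinnertonDyer.BirchSwinnertonDyer.Theorems
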